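import Summits.ABC.IUTFork.Cor312LogKummerRoute
import Summits.ABC.IUTFork.Thm311LinkCompat
import HarnessLib

/-!
# [IUTchIII] Corollary 3.12 — the log-Kummer route, II: through the typed Theorem 3.11 (ii) (TEAM B, B-1)

Record-only file (D-0012) of the abc-iut cell (Cor. 3.12 strategy TEAM B «estimate / log-Kummer» of HUMAN
RULING D-0067 (3), row B-1 layer 2, seat abc-iut-c312-11); TAKES NO SIDE. Layer 1
(`Cor312LogKummerRoute`) proves the printed Statement of Cor. 3.12 from c312-6's bridge hypotheses plus
ONE volume-level input, `VolumeTransport` — a comparison of CORIC log-volume readings ((S.D n).logvol).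
THIS layer pushes the route through the typed log-Kummer correspondence of [IUTchIII] Thm. 3.11 (ii)
(c312-1's `Thm311.Column`, landed): clause (a) — `Column.KummerA` — says the Kummer isomorphisms
transport the HOLOMORPHIC log-volumes at every `(n, m)` to the coric mono-analytic log-volume, "all of
which are compatible with the respective log-volumes [cf. Proposition 3.9, (ii)]" (p. 155). Hence:

* `FrobVolumeTransport` — the B-INPUT moved to the holomorphic side: the `q`-pilot contribution is at
  most the `(n,m)`-HOLOMORPHIC log-volume (`Column.frobLogvol`) of the `m`-th Kummer image of the Θ-pilot
  object, for some `m`. PROVED equivalent in force to layer 1's input under (ii) (a) + admissibility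
  (`volumeTransport_of_frobVolumeTransport`).
* `QRegionAdm` — admissibility of the `q`-pilot image (Rmk. 3.9.5 (ix) (cQ3): an arithmetic vector
  bundle region; real discharge = row B-3 / team A row A-0).
* `QFrobComparison` — **THE RESIDUAL B-INPUT**: for some lattice position `m`, the holomorphic
  log-volume reading of the `q`-pilot image is at most that of the `m`-th Kummer image of the Θ-pilot
  object — BOTH readings now on the SAME side of the log-Kummer correspondence (`Column.frobLogvol m`).
  This is Step (xi-g)'s "two tautologically equivalent ways to compute the log-volume of the `q`-pilot
  object at `(1, 0)`" (p. 184 l. 30–34) in its purest typed form: the gluing of (xi-a) asserts the two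
  computations agree; Scholze–Stix §2.2 locate their objection exactly here (which copies of `ℝ` carry
  the two readings). HYPOTHESIS — never asserted.
* `statement_of_qFrobComparison` / `statement_of_partII` / `statement_of_thm311` — **PROVED**: bridge
  hypotheses + admissibility of the two pilot images + `QFrobComparison` + the typed Theorem 3.11 (ii)
  (resp. the whole typed Theorem 3.11, `FullSituation.Statement`) ⟹ the printed Statement. So, against
  the typed Thm 3.11, the log-Kummer route to Cor. 3.12 is CLOSED MODULO: `ThetaRegionsAdm`,
  `QRegionAdm` (admissibility side conditions; real discharges owned by rows B-3/A-0) and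
  `QFrobComparison` (the disputed comparison). Whether `QFrobComparison` follows from the frozen FACT
  LIST is Team B's adjudication target; if not, it is the GAP-LEDGER row this route nominates.
* Non-vacuity: a toy lattice situation over c312-7's `toySituation 0` with a Kummer-exact column; the
  route runs end to end (`example`).

Sources read on the page: [IUTchIII] p. 155–156 (Thm. 3.11 (ii) (a), final clause), p. 181 l. 33–44
((xi-a)), p. 184 l. 30–34 ((xi-g)); Scholze–Stix 2018 §2.2 pp. 9–10. [claim: Mochizuki2012, status: disputed]
[cite: ScholzeStix2018, §2.2]
Deliberately NOT here: any claim that `QFrobComparison` holds or fails, the real discharges, any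
judgement.
-/

noncomputable section

namespace Summit.ABC

namespace IUTFork

namespace Cor312Vol

open Thm311 Cor312 Literature.IUT.LogThetaLattice

/-! ## 1. Admissibility of the `q`-pilot image (situation level) -/

section SituationLevel

variable {T : ThetaIndex} {S : Situation T} (P : Cor312.Setting S)

/-- **Admissibility of the `q`-pilot image** at the labels of `𝔽_l^⋇` ([IUTchIII] Rmk. 3.9.5 (ix) (cQ3):
the `q`-pilot image is an arithmetic-vector-bundle region, hence carries a log-volume; its hull-set
membership is the Setting's own `qRegion_mem`, admissibility of hull-sets is `hul_adm` — so this
hypothesis is DISCHARGEABLE from the Setting: `qRegionAdm_of_hul_adm`). HYPOTHESIS named for the route.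
[claim: Mochizuki2012, status: disputed] -/
@[claim "Mochizuki2012" "disputed"] def QRegionAdm : Prop :=
  ∀ (i : Fin T.lstar) (vQ : T.VQ),
    (S.D P.n).Adm (Setting.labelSucc i) vQ (P.qRegion (Setting.labelSucc i) vQ)

/-- The `q`-pilot image IS admissible in every setting: it is a hull-set (`Setting.qRegion_mem`) and
hull-sets are admissible (`Setting.hul_adm`). PROVED — `QRegionAdm` carries no content beyond the
Setting's own data fields. [folklore] -/
theorem qRegionAdm_of_hul_adm : QRegionAdm P :=
  fun i vQ => P.hul_adm (Setting.labelSucc i) vQ _ (P.qRegion_mem (Setting.labelSucc i) vQ)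

/-- **Row B-3 discharge shape for the Θ-side**: if each Kummer image of the Θ-pilot object is a HULL-SET
of its packet frame (the reading [IUTchIII] Rmk. 3.9.5 (ix) (cQ1)–(cQ3) gives the pilot images as
`λ·𝒪`-regions), then `ThetaRegionsAdm` holds — by the same `hul_adm` that handles the `q`-side. PROVED;
the hull-set membership itself is the real-instance obligation (rows B-3 / A-0). [folklore] -/
theorem thetaRegionsAdm_of_mem_hul
    (h : ∀ (m : ℤ) (i : Fin T.lstar) (vQ : T.VQ),
      P.thetaRegion m (Setting.labelSucc i) vQ ∈ (P.frame (Setting.labelSucc i) vQ).Hul) :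
    ThetaRegionsAdm P :=
  fun m i vQ => P.hul_adm (Setting.labelSucc i) vQ _ (h m i vQ)

end SituationLevel

/-! ## 2. The route through the typed Theorem 3.11 (ii) (lattice level) -/

section LatticeLevel

variable {T : ThetaIndex} {S' : LatticeSituation T} (P : Cor312.Setting S'.toSituation)

/-- **The B-INPUT at the holomorphic level**: the `q`-pilot contribution to `−|log(q)|` is at most the
`(n,m)`-holomorphic log-volume reading (`Column.frobLogvol`, Thm. 3.11 (ii) (a)) of the `m`-th Kummer
image of the Θ-pilot object, for some `m ∈ ℤ`. HYPOTHESIS. [claim: Mochizuki2012, status: disputed] -/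
@[claim "Mochizuki2012" "disputed"] def FrobVolumeTransport : Prop :=
  ∀ (i : Fin T.lstar) (vQ : T.VQ), ∃ m : ℤ,
    P.qLocal (Setting.labelSucc i) vQ ≤
      (S'.col P.n).frobLogvol m (Setting.labelSucc i) vQ (P.thetaRegion m (Setting.labelSucc i) vQ)

/-- **THE RESIDUAL B-INPUT — the (xi-g) comparison with both sides on the holomorphic side of the
log-Kummer correspondence**: for some lattice position `m`, the holomorphic log-volume reading of the
`q`-pilot image is at most that of the `m`-th Kummer image of the Θ-pilot object ("two tautologically
equivalent ways to compute the log-volume of the `q`-pilot object at `(1,0)`", p. 184 l. 30–34, relaxed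
to `≤`; Scholze–Stix §2.2 object exactly here). HYPOTHESIS — never asserted; Team B's adjudication
target against the frozen FACT LIST. [claim: Mochizuki2012, status: disputed] -/
@[claim "Mochizuki2012" "disputed"] def QFrobComparison : Prop :=
  ∀ (i : Fin T.lstar) (vQ : T.VQ), ∃ m : ℤ,
    (S'.col P.n).frobLogvol m (Setting.labelSucc i) vQ (P.qRegion (Setting.labelSucc i) vQ) ≤
      (S'.col P.n).frobLogvol m (Setting.labelSucc i) vQ (P.thetaRegion m (Setting.labelSucc i) vQ)

/-- The UNIFORM, EQUALITY form of the residual B-INPUT — the (xi-g) sentence as printed ("two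
tautologically equivalent ways to COMPUTE the log-volume of the `q`-pilot object at `(1,0)`", one gluing
position for all packets; the print's position is `m = 0`): at ONE `m`, the two holomorphic readings
AGREE in every packet. HYPOTHESIS. [claim: Mochizuki2012, status: disputed] -/
@[claim "Mochizuki2012" "disputed"] def QFrobEqualityAt (m : ℤ) : Prop :=
  ∀ (i : Fin T.lstar) (vQ : T.VQ),
    (S'.col P.n).frobLogvol m (Setting.labelSucc i) vQ (P.qRegion (Setting.labelSucc i) vQ) =
      (S'.col P.n).frobLogvol m (Setting.labelSucc i) vQ (P.thetaRegion m (Setting.labelSucc i) vQ)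

variable {P}

/-- The printed (uniform, equality) form implies the route's (pointwise, `≤`) form. [folklore] -/
theorem qFrobComparison_of_equalityAt {m : ℤ} (h : QFrobEqualityAt P m) : QFrobComparison P :=
  fun i vQ => ⟨m, (h i vQ).le⟩

/-- Under Thm. 3.11 (ii) (a) (`Column.KummerA`: the Kummer transports are "compatible with the respective
log-volumes") and admissibility of the Kummer images, the holomorphic-side input gives layer 1's
coric-side input. PROVED. [folklore] -/
theorem volumeTransport_of_frobVolumeTransport (hka : (S'.col P.n).KummerA (S'.D P.n))
    (hadm : ThetaRegionsAdm P) (h : FrobVolumeTransport P) : VolumeTransport P := by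
  intro i vQ
  obtain ⟨m, hm⟩ := h i vQ
  exact ⟨m, by rw [← (hka m (Setting.labelSucc i) vQ _ (hadm m i vQ)).2]; exact hm⟩

/-- Under (ii) (a) and admissibility of the `q`-pilot image, the holomorphic-side comparison gives the
holomorphic-side transport: the `q`-pilot's coric reading `qLocal` IS its holomorphic reading at every
`m` (that is exactly the log-volume compatibility of the Kummer isomorphism at the `q`-pilot image).
PROVED. [folklore] -/
theorem frobVolumeTransport_of_qFrobComparison (hka : (S'.col P.n).KummerA (S'.D P.n))
    (hqadm : QRegionAdm P) (h : QFrobComparison P) : FrobVolumeTransport P := by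
  intro i vQ
  obtain ⟨m, hm⟩ := h i vQ
  refine ⟨m, ?_⟩
  calc P.qLocal (Setting.labelSucc i) vQ
      = (S'.col P.n).frobLogvol m (Setting.labelSucc i) vQ (P.qRegion (Setting.labelSucc i) vQ) :=
        ((hka m (Setting.labelSucc i) vQ _ (hqadm i vQ)).2).symm
    _ ≤ (S'.col P.n).frobLogvol m (Setting.labelSucc i) vQ
          (P.thetaRegion m (Setting.labelSucc i) vQ) := hm

variable (P) in
/-- **THE LOG-KUMMER ROUTE THROUGH THEOREM 3.11 (ii) (a)**: bridge hypotheses + admissible Kummer images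
+ `QFrobComparison` + `Column.KummerA` ⟹ the printed Statement (admissibility of the `q`-pilot image is
supplied by the Setting itself, `qRegionAdm_of_hul_adm`). PROVED; nothing asserted.
[claim: Mochizuki2012, status: disputed] -/
theorem statement_of_qFrobComparison (H : BridgeHyps P) (hka : (S'.col P.n).KummerA (S'.D P.n))
    (hadm : ThetaRegionsAdm P) (h : QFrobComparison P) : P.Statement :=
  statement_of_volumeTransport P H hadm
    (volumeTransport_of_frobVolumeTransport hka hadm
      (frobVolumeTransport_of_qFrobComparison hka (qRegionAdm_of_hul_adm P) h))

variable (P) in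
/-- The same against the typed **Theorem 3.11 (ii)** of the lattice situation (c312-1's
`LatticeSituation.PartII`; (ii) (a) is its first conjunct per column). PROVED.
[claim: Mochizuki2012, status: disputed] -/
theorem statement_of_partII (H : BridgeHyps P) (hii : S'.PartII) (hadm : ThetaRegionsAdm P)
    (h : QFrobComparison P) : P.Statement :=
  statement_of_qFrobComparison P H (hii P.n).1 hadm h

end LatticeLevel

/-! ## 3. Against the whole typed Theorem 3.11 -/

section FullLevel

variable {T : ThetaIndex} {S'' : FullSituation T} (P : Cor312.Setting S''.toSituation)

/-- **TEAM B HEADLINE (so far)**: against the WHOLE typed Theorem 3.11 (c312-1's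
`FullSituation.Statement` = (i) ∧ (ii) ∧ (iii)), the log-Kummer route to the printed Statement of
Cor. 3.12 is CLOSED MODULO exactly: the bridge hypotheses (c312-6; finiteness side), admissibility of
the Kummer images (`ThetaRegionsAdm`, row B-3), and the (xi-g) comparison `QFrobComparison` — the
residual B-INPUT this route nominates for the GAP LEDGER if it does not follow from the frozen FACT
LIST. PROVED; nothing asserted. [claim: Mochizuki2012, status: disputed] -/
theorem statement_of_thm311 (H : BridgeHyps P) (h311 : S''.Statement) (hadm : ThetaRegionsAdm P)
    (h : QFrobComparison (S' := S''.toLatticeSituation) P) : P.Statement :=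
  statement_of_partII P H h311.2.1 hadm h

end FullLevel

/-! ## 4. Non-vacuity: a Kummer-exact toy column over c312-7's toy situation -/

namespace Checks

open Cor312.Checks

/-- A column over the toy shells whose transported (holomorphic) readings are literally the coric data
of `toyData 0` — the Kummer isomorphisms are "exact" here. [folklore] -/
def toyColumn0 : Column (toySituation 0).L where
  frobAdm := fun _ j vQ A => (toyData 0).Adm j vQ A
  frobLogvol := fun _ j vQ A => (toyData 0).logvol j vQ A
  frobΨ := fun _ _ _ => ∅
  frobMmod := fun _ _ => ∅
  unitImage := fun _ _ _ _ => Set.univ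
  ballImage := fun _ _ _ => Set.univ
  ObjLGP := Unit
  frobObjLGP := fun _ => Unit
  kumLGP := fun _ => Equiv.refl Unit
  ObjLgp := Unit
  frobObjLgp := fun _ => Unit
  kumLgp := fun _ => Equiv.refl Unit
  thetaPilot := fun _ => ()

/-- The toy lattice situation: c312-7's toy situation with the Kummer-exact column on every line.
[folklore] -/
def toyLatticeNE : LatticeSituation Cor312.Checks.toyIndex where
  toSituation := toySituation 0
  col := fun _ => toyColumn0

/-- (ii) (a) holds for the toy column (the readings coincide). [folklore] -/
theorem toyColumn0_kummerA : toyColumn0.KummerA (toyData 0) :=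
  fun _ _ _ _ hA => ⟨hA, rfl⟩

/-- The `q`-pilot and Θ-pilot regions of the nonempty toy coincide (`univ`), so the (xi-g) comparison
holds there. [folklore] -/
theorem qFrobComparison_toySettingNE :
    QFrobComparison (S' := toyLatticeNE) toySettingNE :=
  fun _ _ => ⟨0, le_rfl⟩

/-- The route through the typed (ii) (a) runs end to end on the toy. [folklore] -/
example : toySettingNE.Statement :=
  statement_of_qFrobComparison (S' := toyLatticeNE) toySettingNE bridgeHyps_toySettingNE
    toyColumn0_kummerA thetaRegionsAdm_toySettingNE qFrobComparison_toySettingNE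

end Checks

end Cor312Vol

end IUTFork

end Summit.ABC

end
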